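import Mathlib.Data.List.Nodup
import Mathlib.Tactic.DeriveFintype
import HarnessLib

/-!
# The Λ = 11 index list of the 2D γ-certificates
(cell `pub-ising3x`, seat controls-1 gen 16; KERNEL PATH for the 2D γ-certificates, Λ = 11 — CONTROL-ONLY scaffolding)

HONEST FRAMING: lottery ticket; floor = tightest certified 3D Ising CFT bounds; no exact-solution
claim without a proof. Nothing about any CFT is asserted here.

Every Λ = 11 derivative functional of the cell (RB-1 gap certificates, RB-2 box certificates; format
`deriv-functional-2d/1,2`) is a table on the same 21 pairs `(m, n)` with `m > n`, `m + n` odd `≤ 11`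
(the certificates' `index_set`, in their order). Shared by all Λ = 11 table / cells / assembly files.
-/

namespace Summit.CriticalPhenomena.Ising3D.Control2D

/-- The Λ = 11 index list: the 21 pairs `(m, n)`, `m > n`, `m + n` odd `≤ 11`. [folklore] -/
def slL11 : List (ℕ × ℕ) := [(1, 0), (3, 0), (2, 1), (5, 0), (4, 1), (3, 2), (7, 0), (6, 1), (5, 2), (4, 3),
  (9, 0), (8, 1), (7, 2), (6, 3), (5, 4), (11, 0), (10, 1), (9, 2), (8, 3), (7, 4), (6, 5)]

/-- [folklore] -/
theorem slL11_nodup : slL11.Nodup := by decide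

/-- [folklore] -/
theorem slL11_deg : ∀ p ∈ slL11, p.1 + p.2 ≤ 11 := by decide

end Summit.CriticalPhenomena.Ising3D.Control2D
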